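import Literature.Analysis.FluidPDE.ElgindiRadialDerivativeCoercivity
import Literature.Analysis.FluidPDE.ElgindiFirstTransportCoercivity
import HarnessLib

/-!
# The local part `𝓛₀ = 𝓛 − (3/(1+z))D_θ` of Elgindi's operator `𝓛_Γ^T` and its `𝓗¹`-block
coercivity on arbitrary test functions ([Elgindi2021] §6.3, the engine of Proposition 6.13)

Topic `Literature/Analysis/FluidPDE`. Support file (one definition with body, everything else
proved; no named facts) on the proof path of the named fact
`Literature.Analysis.FluidPDE.Elgindi.ElgindiGhoulMasmoudi2021_stabilityCore`
(`ElgindiStabilityDecomposition.lean`). T. M. Elgindi, Ann. of Math. 194 (2021) =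
arXiv:1904.04795 (`[Elgindi2021]`), §6.3 "Higher order derivatives and the inner product on `𝓗ᵏ`",
proof of **Proposition 6.13** (p. 18 of the held text):

> "`(𝓛_Γ^T(f), f)_{𝓗ᵏ} ≥ c_{k−1}|f|²_{𝓗^{k−1}} + c_{1,k}(D_θ𝓛_Γ^T(f), D_θf)_{𝓗^{k−1}} +
> c_{2,k}(D_z𝓛_Γ^T(f), D_zf)_{𝓗^{k−1}}`. Now, as in the proof of Proposition 6.5, we note that
> `D_θ𝓛_Γ^T(f) = 𝓛_Γ^T(D_θf) + E₁` … `|E₁|_{𝓗^{k−1}} ≤ C̄_k|f|_{𝓗^{k−1}}`. This is because `L₁₂` is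
> actually smoothing in `θ` … `D_z(𝓛_Γ^T(f)) = 𝓛_Γ^T(D_zf) + E₂`, where `|E₂|_{𝓗^{k−1}} ≤
> C̄_k(|f|_{𝓗^{k−1}} + |D_θf|_{𝓗^{k−1}})`."

To run this induction one needs the level-`1` coercivity (Corollary 6.11) for the derivatives
`D_θf`, `D_zf` of a test function `f`; since `L₁₂(D_θf)(0) ≠ 0` in general, the honest form of the
printed step is: split `𝓛_Γ^T = 𝓛₀ + 𝓚`, `𝓛₀f := 𝓛f − (3/(1+z))D_θf` (local part: `𝓛` and the
angular transport) and `𝓚f := −(2zΓ/(c(1+z)²))L₁₂(f) + L₁₂((3/(1+z))D_θf)(0)·(Γ/c)(2z²/(1+z)³)`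
(the non-local rank-`L₁₂` part, "smoothing in `θ`"), and use that **`𝓛₀` is coercive in the
`𝓗¹`-block of Definition 6.10 on every test function, with no `L₁₂`-condition** — which is what the
local halves of the proofs of Propositions 6.4, 6.5, 6.7, 6.9 give. This file: the definition of
`𝓛₀` (`opLT0`), the decomposition `𝓛_Γ^T = 𝓛₀ + 𝓚` (`opLΓT_eq_opLT0`), the commutators
`D_θ𝓛₀ = 𝓛₀D_θ`, `D_z𝓛₀ = 𝓛₀D_z + (2z/(1+z)²) + (3z/(1+z)²)D_θ` on the open strip, the four weighted
pairings of `𝓛₀u` against `u` (`η`-weight: `≥ (47/100)X_u`; no weight: `≥ (93/200)A_u − (450/7)Y⁰_u`;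
`D_θ`, `γ`-weight: `≥ (½ − 3α/10)Y_u`; `D_z`, `η`-weight: `≥ (39/100)Z_u − 2X_u − 4Y_u`), and the block
estimate `X_u + Z_u + Y_u ≤ 10(D_z𝓛₀u, D_zu)_η + 10¹⁰(𝓛₀u, u)_η + 10¹⁷(𝓛₀u, u) + 10²¹(D_θ𝓛₀u, D_θu)_γ`
for `0 ≤ α ≤ 1` and `u ∈ C³` compactly supported inside the open strip
(`X_u = ∬(uw)²sin^{−η}`, `Z_u = ∬(D_zu·w)²sin^{−η}`, `Y_u = ∬(D_θu·w)²sin^{−γ}`, `A_u = ∬(uw)²`,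
`Y⁰_u = ∬(D_θu·w)²`).
-/

noncomputable section

open MeasureTheory Set Function Real Filter
open _root_.Topology

namespace Literature.Analysis.FluidPDE

namespace Elgindi

/-! ### The local part `𝓛₀` -/

/-- **The local part of `𝓛_Γ^T`**: `𝓛₀f = 𝓛f − (3/(1+z))D_θf = f + z∂_zf − 2f/(1+z) −
(3/(1+z))sin(2θ)∂_θf` (the terms of [Elgindi2021] Definition 6.1 without `L₁₂`). [cite: Elgindi2021, §6 Definition 6.1 and §6.3 proof of Proposition 6.13 (pp. 16, 18 of arXiv:1904.04795)] -/
def opLT0 (f : ℝ → ℝ → ℝ) (z θ : ℝ) : ℝ :=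
  opL f z θ - 3 / (1 + z) * Dθ f z θ

/-- Unfolding `𝓛₀`. [folklore] -/
theorem opLT0_apply (f : ℝ → ℝ → ℝ) (z θ : ℝ) : opLT0 f z θ = opL f z θ - 3 / (1 + z) * Dθ f z θ := rfl

/-- **`𝓛_Γ^T = 𝓛₀ + 𝓚`**: `𝓛_Γ^Tf = 𝓛₀f − (2zΓ/(c(1+z)²))L₁₂(f) + L₁₂((3/(1+z))D_θf)(0)·(Γ/c)(2z²/(1+z)³)`. [cite: Elgindi2021, §6 Definitions 6.1–6.2 (p. 16 of arXiv:1904.04795)] -/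
theorem opLΓT_eq_opLT0 (α : ℝ) (f : ℝ → ℝ → ℝ) (z θ : ℝ) :
    opLΓT α f z θ = opLT0 f z θ - 2 * z * angularWeight α θ / (profileConst α * (1 + z) ^ 2) * L12 f z
      + L12 (fun z θ => 3 / (1 + z) * Dθ f z θ) 0 * projKernel α z θ := by
  rw [opLΓT_apply, opLΓ_apply, projP, opLT0_apply]
  ring

/-! ### Commutators of `𝓛₀` with `D_θ` and `D_z` on the open strip -/

/-- **`D_θ𝓛₀ = 𝓛₀D_θ`** on the open strip, `f ∈ C²(strip)` (the transport coefficient is radial). [cite: Elgindi2021, §6.3 proof of Proposition 6.13 (p. 18 of arXiv:1904.04795)] -/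
theorem Dθ_opLT0 {f : ℝ → ℝ → ℝ} (hf : ContDiffOn ℝ 2 (uncurry f) strip) {p : ℝ × ℝ} (hp : p ∈ strip) :
    Dθ (opLT0 f) p.1 p.2 = opLT0 (Dθ f) p.1 p.2 := by
  have hfd : DifferentiableAt ℝ (fun θ => f p.1 θ) p.2 :=
    (hasDerivAt_slice_snd (differentiableAt_of_contDiffOn_strip hf (by simp) hp)).differentiableAt
  have h1z : ContDiffOn ℝ 1 (uncurry (Dz f)) strip := contDiffOn_Dz (n := 1) hf
  have hDzd : DifferentiableAt ℝ (fun θ => Dz f p.1 θ) p.2 :=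
    (hasDerivAt_slice_snd (differentiableAt_of_contDiffOn_strip h1z one_ne_zero hp)).differentiableAt
  have h1θ : ContDiffOn ℝ 1 (uncurry (Dθ f)) strip := contDiffOn_Dθ (n := 1) hf
  have hDθd : DifferentiableAt ℝ (fun θ => Dθ f p.1 θ) p.2 :=
    (hasDerivAt_slice_snd (differentiableAt_of_contDiffOn_strip h1θ one_ne_zero hp)).differentiableAt
  have hopLd : DifferentiableAt ℝ (fun θ => opL f p.1 θ) p.2 := by
    have e : (fun θ => opL f p.1 θ) = fun θ => (f p.1 θ + Dz f p.1 θ) - 2 / (1 + p.1) * f p.1 θ := by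
      funext θ; simp only [opL_apply]; ring
    rw [e]
    exact (hfd.add hDzd).sub (hfd.const_mul _)
  have hT3d : DifferentiableAt ℝ (fun θ => 3 / (1 + p.1) * Dθ f p.1 θ) p.2 := hDθd.const_mul _
  have e : (fun θ => opLT0 f p.1 θ) = fun θ => opL f p.1 θ - 3 / (1 + p.1) * Dθ f p.1 θ := by
    funext θ; rfl
  have hmain : deriv (fun θ => opLT0 f p.1 θ) p.2 =
      deriv (fun θ => opL f p.1 θ) p.2 - deriv (fun θ => 3 / (1 + p.1) * Dθ f p.1 θ) p.2 := by
    rw [e, (hopLd.hasDerivAt.fun_sub hT3d.hasDerivAt).deriv]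
  have d1 : Real.sin (2 * p.2) * deriv (fun θ => opL f p.1 θ) p.2 = opL (Dθ f) p.1 p.2 := by
    rw [← Dθ_apply]; exact Dθ_opL hf hp
  have d3 : Real.sin (2 * p.2) * deriv (fun θ => 3 / (1 + p.1) * Dθ f p.1 θ) p.2 =
      3 / (1 + p.1) * Dθ (Dθ f) p.1 p.2 := by
    rw [deriv_const_mul _ hDθd, Dθ_apply]; ring
  rw [Dθ_apply, hmain, mul_sub, d1, d3, opLT0_apply]

/-- **`D_z𝓛₀ = 𝓛₀D_z + (2z/(1+z)²)· + (3z/(1+z)²)D_θ`** on the open strip, `f ∈ C²(strip)`: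
`D_z(𝓛₀f) = 𝓛₀(D_zf) + (2z/(1+z)²)f + (3z/(1+z)²)D_θf` (the terms `I₁, I₂, I₅, I₆` of the proof of
Prop. 6.9). [cite: Elgindi2021, §6.2 proof of Proposition 6.9 and §6.3 proof of Proposition 6.13 (pp. 17–18 of arXiv:1904.04795)] -/
theorem Dz_opLT0 {f : ℝ → ℝ → ℝ} (hf : ContDiffOn ℝ 2 (uncurry f) strip) {p : ℝ × ℝ} (hp : p ∈ strip) :
    Dz (opLT0 f) p.1 p.2 = opLT0 (Dz f) p.1 p.2 + 2 * p.1 / (1 + p.1) ^ 2 * f p.1 p.2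
      + 3 * p.1 / (1 + p.1) ^ 2 * Dθ f p.1 p.2 := by
  have hz0 : (0 : ℝ) < p.1 := hp.1
  have hz1 : (1 : ℝ) + p.1 ≠ 0 := by positivity
  have h1θ : ContDiffOn ℝ 1 (uncurry (Dθ f)) strip := contDiffOn_Dθ (n := 1) hf
  have hDθd : HasDerivAt (fun z => Dθ f z p.2) (dz (Dθ f) p.1 p.2) p.1 := hasDerivAt_slice_fst_dz h1θ hp
  have hden : HasDerivAt (fun z : ℝ => 1 + z) 1 p.1 := by simpa using (hasDerivAt_id' p.1).const_add 1
  -- `C¹` regularity of `𝓛 f` on the strip, for the slice derivative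
  have hopL1 : ContDiffOn ℝ 1 (uncurry (opL f)) strip := by
    have h1 : ContDiffOn ℝ 1 (uncurry f) strip := hf.of_le (by norm_num)
    have h2 : ContDiffOn ℝ 1 (uncurry (Dz f)) strip := contDiffOn_Dz (n := 1) hf
    have h3 : ContDiffOn ℝ 1 (fun q : ℝ × ℝ => 2 * f q.1 q.2 / (1 + q.1)) strip :=
      (contDiffOn_const.mul h1).div (by fun_prop) fun q hq => by
        have : (0 : ℝ) < q.1 := hq.1; positivity
    exact ((h1.add h2).sub h3).congr fun q _ => by simp only [Function.uncurry, opL_apply]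
  have hopL : HasDerivAt (fun z => opL f z p.2) (deriv (fun z => opL f z p.2) p.1) p.1 :=
    (hasDerivAt_slice_fst (differentiableAt_of_contDiffOn_strip hopL1 one_ne_zero hp)).differentiableAt.hasDerivAt
  have hT3 : HasDerivAt (fun z => 3 / (1 + z) * Dθ f z p.2)
      (3 * (-1 / (1 + p.1) ^ 2) * Dθ f p.1 p.2 + 3 * (1 + p.1)⁻¹ * dz (Dθ f) p.1 p.2) p.1 := by
    have hinv : HasDerivAt (fun z : ℝ => 3 * (1 + z)⁻¹) (3 * (-1 / (1 + p.1) ^ 2)) p.1 :=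
      (hden.fun_inv hz1).const_mul 3
    have e3 : (fun z => 3 / (1 + z) * Dθ f z p.2) = fun z => 3 * (1 + z)⁻¹ * Dθ f z p.2 := by
      funext z
      rw [div_eq_mul_inv]
    rw [e3]
    exact hinv.fun_mul hDθd
  have e : (fun z => opLT0 f z p.2) = fun z => opL f z p.2 - 3 / (1 + z) * Dθ f z p.2 := by
    funext z; rfl
  have hDz1 : Dz (opL f) p.1 p.2 = p.1 * deriv (fun z => opL f z p.2) p.1 := by rw [Dz_eq_mul_dz, dz]
  have hcomm : p.1 * dz (Dθ f) p.1 p.2 = Dθ (Dz f) p.1 p.2 := by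
    rw [Dθ_Dz_comm hf hp, Dz_eq_mul_dz]
  rw [Dz_eq_mul_dz, dz, e, (hopL.fun_sub hT3).deriv, mul_sub, ← hDz1, Dz_opL hf hp, opLT0_apply, ← hcomm]
  field_simp
  ring

/-! ### Integrability of unweighted pairings -/

/-- Integrability on the strip of `c·f·w²` for `c` continuous on the strip and `f ∈ C¹` compactly
supported inside the open strip. [folklore] -/
theorem integrableOn_mul_f_radialWeight_sq {f : ℝ → ℝ → ℝ} (hf : ContDiff ℝ 1 (uncurry f))
    (hs : HasCompactSupport (uncurry f)) (hsub : tsupport (uncurry f) ⊆ strip) {c : ℝ × ℝ → ℝ}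
    (hc : ContinuousOn c strip) :
    IntegrableOn (fun p : ℝ × ℝ => c p * f p.1 p.2 * radialWeight p.1 ^ 2) strip := by
  have hf0 : ∀ p : ℝ × ℝ, p ∉ tsupport (uncurry f) → f p.1 p.2 = 0 := fun p hp =>
    (image_eq_zero_of_notMem_tsupport hp : uncurry f p = 0)
  have hwon : ContinuousOn (fun p : ℝ × ℝ => radialWeight p.1) strip := by
    unfold radialWeight
    exact ContinuousOn.div (by fun_prop) (by fun_prop) fun p hp => pow_ne_zero 2 (ne_of_gt hp.1)
  have hc' : Continuous fun p : ℝ × ℝ => c p * f p.1 p.2 * radialWeight p.1 ^ 2 :=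
    continuous_of_continuousOn_strip (isClosed_tsupport _) hsub
      ((hc.mul hf.continuous.continuousOn).mul (hwon.pow 2)) fun p hp => by simp [hf0 p hp]
  exact (hc'.integrable_of_hasCompactSupport (HasCompactSupport.intro hs fun p hp => by
    simp [hf0 p hp])).integrableOn

/-! ### The four pairings of `𝓛₀u` against a test function `u` -/

/-- Continuity of `𝓛 u` on the strip for `u ∈ C²`. [folklore] -/
theorem continuousOn_opL {u : ℝ → ℝ → ℝ} (hu : ContDiff ℝ 2 (uncurry u)) :
    ContinuousOn (fun p : ℝ × ℝ => opL u p.1 p.2) strip := by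
  have huon : ContinuousOn (fun p : ℝ × ℝ => u p.1 p.2) strip := hu.continuous.continuousOn
  have hdz : ContinuousOn (fun p : ℝ × ℝ => Dz u p.1 p.2) strip :=
    (continuous_fst.mul (continuous_dz (hu.of_le (by norm_num)))).continuousOn
  have h3 : ContinuousOn (fun p : ℝ × ℝ => 2 * u p.1 p.2 / (1 + p.1)) strip :=
    (continuousOn_const.mul huon).div (by fun_prop) fun p hp => by
      have : (0 : ℝ) < p.1 := hp.1; positivity
  exact ((huon.add hdz).sub h3).congr fun p _ => by simp only [Pi.add_apply, Pi.sub_apply, opL_apply]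

/-- Continuity of `𝓛₀ u` on the strip for `u ∈ C²`. [folklore] -/
theorem continuousOn_opLT0 {u : ℝ → ℝ → ℝ} (hu : ContDiff ℝ 2 (uncurry u)) :
    ContinuousOn (fun p : ℝ × ℝ => opLT0 u p.1 p.2) strip := by
  have hDon : ContinuousOn (fun p : ℝ × ℝ => Dθ u p.1 p.2) strip :=
    (continuous_Dθ (hu.of_le (by norm_num))).continuousOn
  have h3 : ContinuousOn (fun p : ℝ × ℝ => 3 / (1 + p.1) * Dθ u p.1 p.2) strip := by
    refine (ContinuousOn.div continuousOn_const (by fun_prop) fun p hp => ?_).mul hDon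
    have : (0 : ℝ) < p.1 := hp.1; positivity
  exact ((continuousOn_opL hu).sub h3).congr fun p _ => by simp only [Pi.sub_apply, opLT0_apply]

/-- **`η`-pairing of `𝓛₀`**: `(47/100)∬(uw)²sin^{−η} ≤ ∬𝓛₀u·u·w²sin^{−η}` for `u ∈ C²` compactly
supported inside the open strip (energy identity `½` and the transport by parts `≥ −3/100`, the
local half of Prop. 6.7). [cite: Elgindi2021, §6.1 Proposition 6.7 (p. 17 of arXiv:1904.04795)] -/
theorem opLT0_pairing_eta_ge {u : ℝ → ℝ → ℝ} (hu : ContDiff ℝ 2 (uncurry u))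
    (hs : HasCompactSupport (uncurry u)) (hsub : tsupport (uncurry u) ⊆ strip) :
    47 / 100 * (∫ p in strip, (u p.1 p.2 * radialWeight p.1) ^ 2 * Real.sin (2 * p.2) ^ (-eta)) ≤
      ∫ p in strip, opLT0 u p.1 p.2 * u p.1 p.2 * radialWeight p.1 ^ 2 * Real.sin (2 * p.2) ^ (-eta) := by
  have hDon : ContinuousOn (fun p : ℝ × ℝ => Dθ u p.1 p.2) strip :=
    (continuous_Dθ (hu.of_le (by norm_num))).continuousOn
  have c3 : ContinuousOn (fun p : ℝ × ℝ => 3 / (1 + p.1) * Dθ u p.1 p.2) strip := by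
    refine (ContinuousOn.div continuousOn_const (by fun_prop) fun p hp => ?_).mul hDon
    have : (0 : ℝ) < p.1 := hp.1; positivity
  have i1 := integrableOn_mul_f_weight_eta hu hs hsub (continuousOn_opL hu)
  have i3 := integrableOn_mul_f_weight_eta hu hs hsub c3
  have hsplit : ∀ p ∈ strip, opLT0 u p.1 p.2 * u p.1 p.2 * radialWeight p.1 ^ 2 * Real.sin (2 * p.2) ^ (-eta) =
      opL u p.1 p.2 * u p.1 p.2 * radialWeight p.1 ^ 2 * Real.sin (2 * p.2) ^ (-eta) -
        3 / (1 + p.1) * Dθ u p.1 p.2 * u p.1 p.2 * radialWeight p.1 ^ 2 * Real.sin (2 * p.2) ^ (-eta) := by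
    intro p _
    rw [opLT0_apply]
    ring
  rw [setIntegral_congr_fun measurableSet_strip hsplit, integral_sub i1 i3,
    integral_strip_opL_energy_weight (hu.of_le (by norm_num)) hs hsub (contDiffOn_sin_two_mul_rpow _)]
  have h3 := integral_transport_eta_ge hu hs hsub
  linarith

/-- **Unweighted pairing of `𝓛₀`**: `(93/200)∬(uw)² − (450/7)∬(D_θu·w)² ≤ ∬𝓛₀u·u·w²` for
`u ∈ C¹` compactly supported inside the open strip (energy identity `½` and the transport pairing
bound, the local half of Prop. 6.4). [cite: Elgindi2021, §6.1 Proposition 6.4 (p. 16 of arXiv:1904.04795)] -/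
theorem opLT0_pairing_ge {u : ℝ → ℝ → ℝ} (hu : ContDiff ℝ 1 (uncurry u))
    (hs : HasCompactSupport (uncurry u)) (hsub : tsupport (uncurry u) ⊆ strip) :
    93 / 200 * (∫ p in strip, (u p.1 p.2 * radialWeight p.1) ^ 2) -
        450 / 7 * (∫ p in strip, (Dθ u p.1 p.2 * radialWeight p.1) ^ 2) ≤
      ∫ p in strip, opLT0 u p.1 p.2 * u p.1 p.2 * radialWeight p.1 ^ 2 := by
  have huon : ContinuousOn (fun p : ℝ × ℝ => u p.1 p.2) strip := hu.continuous.continuousOn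
  have hDon : ContinuousOn (fun p : ℝ × ℝ => Dθ u p.1 p.2) strip := (continuous_Dθ hu).continuousOn
  have c1 : ContinuousOn (fun p : ℝ × ℝ => opL u p.1 p.2) strip := by
    have hdz : ContinuousOn (fun p : ℝ × ℝ => Dz u p.1 p.2) strip :=
      (continuous_fst.mul (continuous_dz hu)).continuousOn
    have h3 : ContinuousOn (fun p : ℝ × ℝ => 2 * u p.1 p.2 / (1 + p.1)) strip :=
      (continuousOn_const.mul huon).div (by fun_prop) fun p hp => by
        have : (0 : ℝ) < p.1 := hp.1; positivity
    exact ((huon.add hdz).sub h3).congr fun p _ => by simp only [Pi.add_apply, Pi.sub_apply, opL_apply]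
  have c3 : ContinuousOn (fun p : ℝ × ℝ => 3 / (1 + p.1) * Dθ u p.1 p.2) strip := by
    refine (ContinuousOn.div continuousOn_const (by fun_prop) fun p hp => ?_).mul hDon
    have : (0 : ℝ) < p.1 := hp.1; positivity
  have i1 := integrableOn_mul_f_radialWeight_sq hu hs hsub c1
  have i3 := integrableOn_mul_f_radialWeight_sq hu hs hsub c3
  have hsplit : ∀ p ∈ strip, opLT0 u p.1 p.2 * u p.1 p.2 * radialWeight p.1 ^ 2 =
      opL u p.1 p.2 * u p.1 p.2 * radialWeight p.1 ^ 2 -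
        3 / (1 + p.1) * Dθ u p.1 p.2 * u p.1 p.2 * radialWeight p.1 ^ 2 := by
    intro p _
    rw [opLT0_apply]
    ring
  rw [setIntegral_congr_fun measurableSet_strip hsplit, integral_sub i1 i3,
    integral_strip_opL_energy hu hs hsub]
  have h3 := abs_le.1 (abs_integral_transport_pairing_le hu hs hsub)
  linarith [h3.1, h3.2]

/-- **`D_θ`-pairing of `𝓛₀`, `γ`-weight**: `(½ − 3α/10)∬(D_θu·w)²sin^{−γ} ≤ ∬D_θ(𝓛₀u)·D_θu·w²sin^{−γ}`
for `α ≥ 0` and `u ∈ C²` compactly supported inside the open strip (`D_θ𝓛₀ = 𝓛₀D_θ`, energy identity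
`½`, transport by parts `O(γ − 1)`: the local half of Prop. 6.5). [cite: Elgindi2021, §6.1 Proposition 6.5 (p. 16 of arXiv:1904.04795)] -/
theorem Dθ_opLT0_pairing_ge {α : ℝ} (hα : 0 ≤ α) {u : ℝ → ℝ → ℝ} (hu : ContDiff ℝ 2 (uncurry u))
    (hs : HasCompactSupport (uncurry u)) (hsub : tsupport (uncurry u) ⊆ strip) :
    (1 / 2 - 3 * α / 10) * (∫ p in strip, (Dθ u p.1 p.2 * radialWeight p.1) ^ 2 *
        Real.sin (2 * p.2) ^ (-gammaExp α)) ≤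
      ∫ p in strip, Dθ (opLT0 u) p.1 p.2 * Dθ u p.1 p.2 * radialWeight p.1 ^ 2 *
        Real.sin (2 * p.2) ^ (-gammaExp α) := by
  have hu2 : ContDiffOn ℝ 2 (uncurry u) strip := hu.contDiffOn
  have hg : ContDiff ℝ 1 (uncurry (Dθ u)) := contDiff_Dθ (n := 1) hu hsub
  have hDgon : ContinuousOn (fun p : ℝ × ℝ => Dθ (Dθ u) p.1 p.2) strip := (continuous_Dθ hg).continuousOn
  have c1 : ContinuousOn (fun p : ℝ × ℝ => opL (Dθ u) p.1 p.2) strip := by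
    have hgon : ContinuousOn (fun p : ℝ × ℝ => Dθ u p.1 p.2) strip := hg.continuous.continuousOn
    have hdz : ContinuousOn (fun p : ℝ × ℝ => Dz (Dθ u) p.1 p.2) strip :=
      (continuous_fst.mul (continuous_dz hg)).continuousOn
    have h3 : ContinuousOn (fun p : ℝ × ℝ => 2 * Dθ u p.1 p.2 / (1 + p.1)) strip :=
      (continuousOn_const.mul hgon).div (by fun_prop) fun p hp => by
        have : (0 : ℝ) < p.1 := hp.1; positivity
    exact ((hgon.add hdz).sub h3).congr fun p _ => by simp only [Pi.add_apply, Pi.sub_apply, opL_apply]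
  have c3 : ContinuousOn (fun p : ℝ × ℝ => 3 / (1 + p.1) * Dθ (Dθ u) p.1 p.2) strip := by
    refine (ContinuousOn.div continuousOn_const (by fun_prop) fun p hp => ?_).mul hDgon
    have : (0 : ℝ) < p.1 := hp.1; positivity
  have i1 := integrableOn_mul_Dθ_weight (α := α) hu hs hsub c1
  have i3 := integrableOn_mul_Dθ_weight (α := α) hu hs hsub c3
  have hsplit : ∀ p ∈ strip, Dθ (opLT0 u) p.1 p.2 * Dθ u p.1 p.2 * radialWeight p.1 ^ 2 *
      Real.sin (2 * p.2) ^ (-gammaExp α) =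
      opL (Dθ u) p.1 p.2 * Dθ u p.1 p.2 * radialWeight p.1 ^ 2 * Real.sin (2 * p.2) ^ (-gammaExp α) -
        3 / (1 + p.1) * Dθ (Dθ u) p.1 p.2 * Dθ u p.1 p.2 * radialWeight p.1 ^ 2 *
          Real.sin (2 * p.2) ^ (-gammaExp α) := by
    intro p hp
    rw [Dθ_opLT0 hu2 hp, opLT0_apply]
    ring
  rw [setIntegral_congr_fun measurableSet_strip hsplit, integral_sub i1 i3, integral_opL_Dθ_energy hu hs hsub]
  have h3 := integral_transport_Dθ_ge hα hu hs hsub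
  linarith

/-- **`D_z`-pairing of `𝓛₀`, `η`-weight**: `(39/100)Z_u − 2X_u − 4Y_u ≤ ∬D_z(𝓛₀u)·D_zu·w²sin^{−η}`
for `α ≥ 0` and `u ∈ C³` compactly supported inside the open strip (`D_z𝓛₀ = 𝓛₀D_z + I₂ + I₅`,
the `η`-pairing of `𝓛₀` on `D_zu`, and the bounds `I₂² ≤ ¼X_uZ_u`, `I₅² ≤ (9/16)Y_uZ_u` of the
proof of Prop. 6.9). [cite: Elgindi2021, §6.2 proof of Proposition 6.9 (p. 17 of arXiv:1904.04795)] -/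
theorem Dz_opLT0_pairing_ge {α : ℝ} (hα : 0 ≤ α) {u : ℝ → ℝ → ℝ} (hu : ContDiff ℝ 3 (uncurry u))
    (hs : HasCompactSupport (uncurry u)) (hsub : tsupport (uncurry u) ⊆ strip) :
    39 / 100 * (∫ p in strip, (Dz u p.1 p.2 * radialWeight p.1) ^ 2 * Real.sin (2 * p.2) ^ (-eta)) -
        2 * (∫ p in strip, (u p.1 p.2 * radialWeight p.1) ^ 2 * Real.sin (2 * p.2) ^ (-eta)) -
        4 * (∫ p in strip, (Dθ u p.1 p.2 * radialWeight p.1) ^ 2 * Real.sin (2 * p.2) ^ (-gammaExp α)) ≤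
      ∫ p in strip, Dz (opLT0 u) p.1 p.2 * Dz u p.1 p.2 * radialWeight p.1 ^ 2 * Real.sin (2 * p.2) ^ (-eta) := by
  have hu2 : ContDiff ℝ 2 (uncurry u) := hu.of_le (by norm_num)
  have hu2' : ContDiffOn ℝ 2 (uncurry u) strip := hu2.contDiffOn
  have hg : ContDiff ℝ 2 (uncurry (Dz u)) := contDiff_Dz (n := 2) hu hsub
  have hgs : HasCompactSupport (uncurry (Dz u)) := hasCompactSupport_Dz hs
  have hgsub : tsupport (uncurry (Dz u)) ⊆ strip := tsupport_Dz_subset.trans hsub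
  have huon : ContinuousOn (fun p : ℝ × ℝ => u p.1 p.2) strip := hu.continuous.continuousOn
  have hDon : ContinuousOn (fun p : ℝ × ℝ => Dθ u p.1 p.2) strip :=
    (continuous_Dθ (hu.of_le (by norm_num))).continuousOn
  have c2 : ContinuousOn (fun p : ℝ × ℝ => 2 * p.1 / (1 + p.1) ^ 2 * u p.1 p.2) strip :=
    (ContinuousOn.div (by fun_prop) (by fun_prop) fun p hp => by
      have : (0 : ℝ) < p.1 := hp.1; positivity).mul huon
  have c5 : ContinuousOn (fun p : ℝ × ℝ => 3 * p.1 / (1 + p.1) ^ 2 * Dθ u p.1 p.2) strip :=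
    (ContinuousOn.div (by fun_prop) (by fun_prop) fun p hp => by
      have : (0 : ℝ) < p.1 := hp.1; positivity).mul hDon
  have i1 := integrableOn_mul_f_weight_eta hg hgs hgsub (continuousOn_opLT0 hg)
  have i2 := integrableOn_mul_f_weight_eta hg hgs hgsub c2
  have i5 := integrableOn_mul_f_weight_eta hg hgs hgsub c5
  have hsplit : ∀ p ∈ strip, Dz (opLT0 u) p.1 p.2 * Dz u p.1 p.2 * radialWeight p.1 ^ 2 * Real.sin (2 * p.2) ^ (-eta) =
      opLT0 (Dz u) p.1 p.2 * Dz u p.1 p.2 * radialWeight p.1 ^ 2 * Real.sin (2 * p.2) ^ (-eta)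
      + 2 * p.1 / (1 + p.1) ^ 2 * u p.1 p.2 * Dz u p.1 p.2 * radialWeight p.1 ^ 2 * Real.sin (2 * p.2) ^ (-eta)
      + 3 * p.1 / (1 + p.1) ^ 2 * Dθ u p.1 p.2 * Dz u p.1 p.2 * radialWeight p.1 ^ 2 *
          Real.sin (2 * p.2) ^ (-eta) := by
    intro p hp
    rw [Dz_opLT0 hu2' hp]
    ring
  have hsum : ∫ p in strip, (opLT0 (Dz u) p.1 p.2 * Dz u p.1 p.2 * radialWeight p.1 ^ 2 * Real.sin (2 * p.2) ^ (-eta)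
      + 2 * p.1 / (1 + p.1) ^ 2 * u p.1 p.2 * Dz u p.1 p.2 * radialWeight p.1 ^ 2 * Real.sin (2 * p.2) ^ (-eta)
      + 3 * p.1 / (1 + p.1) ^ 2 * Dθ u p.1 p.2 * Dz u p.1 p.2 * radialWeight p.1 ^ 2 *
          Real.sin (2 * p.2) ^ (-eta)) =
      (∫ p in strip, opLT0 (Dz u) p.1 p.2 * Dz u p.1 p.2 * radialWeight p.1 ^ 2 * Real.sin (2 * p.2) ^ (-eta))
      + (∫ p in strip, 2 * p.1 / (1 + p.1) ^ 2 * u p.1 p.2 * Dz u p.1 p.2 * radialWeight p.1 ^ 2 *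
          Real.sin (2 * p.2) ^ (-eta))
      + ∫ p in strip, 3 * p.1 / (1 + p.1) ^ 2 * Dθ u p.1 p.2 * Dz u p.1 p.2 * radialWeight p.1 ^ 2 *
          Real.sin (2 * p.2) ^ (-eta) := by
    rw [integral_add, integral_add]
    all_goals first
      | exact i1
      | exact i2
      | exact i5
      | exact i1.add i2
  rw [setIntegral_congr_fun measurableSet_strip hsplit, hsum]
  have h1 := opLT0_pairing_eta_ge hg hgs hgsub
  have h2 := sq_I2_le hu hs hsub
  have h5 := sq_I5_le hu hs hsub hα
  set X : ℝ := ∫ p in strip, (u p.1 p.2 * radialWeight p.1) ^ 2 * Real.sin (2 * p.2) ^ (-eta) with hX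
  set Y : ℝ := ∫ p in strip, (Dθ u p.1 p.2 * radialWeight p.1) ^ 2 * Real.sin (2 * p.2) ^ (-gammaExp α) with hY
  set Z : ℝ := ∫ p in strip, (Dz u p.1 p.2 * radialWeight p.1) ^ 2 * Real.sin (2 * p.2) ^ (-eta) with hZ
  have hX0 : 0 ≤ X := by
    simp only [hX]
    refine setIntegral_nonneg measurableSet_strip fun p hp => ?_
    have hsθ : 0 < Real.sin (2 * p.2) := Real.sin_pos_of_pos_of_lt_pi (by linarith [hp.2.1]) (by linarith [hp.2.2])
    exact mul_nonneg (sq_nonneg _) (Real.rpow_nonneg hsθ.le _)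
  have hY0 : 0 ≤ Y := by
    simp only [hY]
    refine setIntegral_nonneg measurableSet_strip fun p hp => ?_
    have hsθ : 0 < Real.sin (2 * p.2) := Real.sin_pos_of_pos_of_lt_pi (by linarith [hp.2.1]) (by linarith [hp.2.2])
    exact mul_nonneg (sq_nonneg _) (Real.rpow_nonneg hsθ.le _)
  have hZ0 : 0 ≤ Z := by
    simp only [hZ]
    refine setIntegral_nonneg measurableSet_strip fun p hp => ?_
    have hsθ : 0 < Real.sin (2 * p.2) := Real.sin_pos_of_pos_of_lt_pi (by linarith [hp.2.1]) (by linarith [hp.2.2])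
    exact mul_nonneg (sq_nonneg _) (Real.rpow_nonneg hsθ.le _)
  have hδ : (0 : ℝ) < 1 / 25 := by norm_num
  have b2 := abs_le.1 (abs_le_of_sq_le_mul (by norm_num) hX0 hZ0 hδ h2)
  have b5 := abs_le.1 (abs_le_of_sq_le_mul (by norm_num) hY0 hZ0 hδ h5)
  linarith [b2.1, b2.2, b5.1, b5.2, h1]

/-! ### The `𝓗¹`-block coercivity of `𝓛₀` on test functions -/

/-- **`𝓗¹`-block coercivity of the local part** (the local content of [Elgindi2021] Cor. 6.11, with
no condition on `L₁₂`): for `0 ≤ α ≤ 1` and `u ∈ C³` compactly supported inside the open strip,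
`∬(uw)²sin^{−η} + ∬(D_zu·w)²sin^{−η} + ∬(D_θu·w)²sin^{−γ} ≤ 10∬D_z(𝓛₀u)·D_zu·w²sin^{−η} +
10¹⁰∬𝓛₀u·u·w²sin^{−η} + 10¹⁷∬𝓛₀u·u·w² + 10²¹∬D_θ(𝓛₀u)·D_θu·w²sin^{−γ}` (the coefficients of
Definition 6.10). [cite: Elgindi2021, §6.2 Definition 6.10, Corollary 6.11 and §6.3 proof of Proposition 6.13 (pp. 17–18 of arXiv:1904.04795)] -/
theorem localBlockCoercivity {α : ℝ} (hα : 0 ≤ α) (hα1 : α ≤ 1) {u : ℝ → ℝ → ℝ}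
    (hu : ContDiff ℝ 3 (uncurry u)) (hs : HasCompactSupport (uncurry u))
    (hsub : tsupport (uncurry u) ⊆ strip) :
    (∫ p in strip, (u p.1 p.2 * radialWeight p.1) ^ 2 * Real.sin (2 * p.2) ^ (-eta)) +
        (∫ p in strip, (Dz u p.1 p.2 * radialWeight p.1) ^ 2 * Real.sin (2 * p.2) ^ (-eta)) +
        (∫ p in strip, (Dθ u p.1 p.2 * radialWeight p.1) ^ 2 * Real.sin (2 * p.2) ^ (-gammaExp α)) ≤
      10 * (∫ p in strip, Dz (opLT0 u) p.1 p.2 * Dz u p.1 p.2 * radialWeight p.1 ^ 2 *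
          Real.sin (2 * p.2) ^ (-eta)) +
        10 ^ 10 * (∫ p in strip, opLT0 u p.1 p.2 * u p.1 p.2 * radialWeight p.1 ^ 2 *
          Real.sin (2 * p.2) ^ (-eta)) +
        10 ^ 17 * (∫ p in strip, opLT0 u p.1 p.2 * u p.1 p.2 * radialWeight p.1 ^ 2) +
        10 ^ 21 * (∫ p in strip, Dθ (opLT0 u) p.1 p.2 * Dθ u p.1 p.2 * radialWeight p.1 ^ 2 *
          Real.sin (2 * p.2) ^ (-gammaExp α)) := by
  have hu2 : ContDiff ℝ 2 (uncurry u) := hu.of_le (by norm_num)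
  have hu1 : ContDiff ℝ 1 (uncurry u) := hu.of_le (by norm_num)
  have hd := Dz_opLT0_pairing_ge hα hu hs hsub
  have he := opLT0_pairing_eta_ge hu2 hs hsub
  have h0 := opLT0_pairing_ge hu1 hs hsub
  have ht := Dθ_opLT0_pairing_ge hα hu2 hs hsub
  have hYw := integral_sq_Dθ_le_weighted hα hu2 hs hsub
  have hAX := integral_sq_le_weighted_eta hu2 hs hsub
  set X : ℝ := ∫ p in strip, (u p.1 p.2 * radialWeight p.1) ^ 2 * Real.sin (2 * p.2) ^ (-eta) with hX
  set Y : ℝ := ∫ p in strip, (Dθ u p.1 p.2 * radialWeight p.1) ^ 2 * Real.sin (2 * p.2) ^ (-gammaExp α) with hY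
  set Z : ℝ := ∫ p in strip, (Dz u p.1 p.2 * radialWeight p.1) ^ 2 * Real.sin (2 * p.2) ^ (-eta) with hZ
  set A : ℝ := ∫ p in strip, (u p.1 p.2 * radialWeight p.1) ^ 2 with hA
  set Yw : ℝ := ∫ p in strip, (Dθ u p.1 p.2 * radialWeight p.1) ^ 2 with hYw'
  have hA0 : 0 ≤ A := integral_nonneg fun p => sq_nonneg _
  have hY0 : 0 ≤ Y := by
    simp only [hY]
    refine setIntegral_nonneg measurableSet_strip fun p hp => ?_
    have hsθ : 0 < Real.sin (2 * p.2) := Real.sin_pos_of_pos_of_lt_pi (by linarith [hp.2.1]) (by linarith [hp.2.2])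
    exact mul_nonneg (sq_nonneg _) (Real.rpow_nonneg hsθ.le _)
  have hZ0 : 0 ≤ Z := by
    simp only [hZ]
    refine setIntegral_nonneg measurableSet_strip fun p hp => ?_
    have hsθ : 0 < Real.sin (2 * p.2) := Real.sin_pos_of_pos_of_lt_pi (by linarith [hp.2.1]) (by linarith [hp.2.2])
    exact mul_nonneg (sq_nonneg _) (Real.rpow_nonneg hsθ.le _)
  have hαY : α * Y ≤ 1 * Y := mul_le_mul_of_nonneg_right hα1 hY0
  nlinarith [hd, he, h0, ht, hYw, hAX, hαY, hA0, hY0, hZ0]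

/-- **`𝓗¹`-block coercivity of the local part, strong form** (keeping the slack of the block
coefficients, which absorbs the cross terms of the `𝓗ᵏ` induction): for `0 ≤ α ≤ 1` and `u ∈ C³`
compactly supported inside the open strip, `(39/10)Z_u + 4·10⁹X_u + 4·10¹⁶A_u + 10²⁰Y_u ≤
10(D_z𝓛₀u, D_zu)_η + 10¹⁰(𝓛₀u, u)_η + 10¹⁷(𝓛₀u, u) + 10²¹(D_θ𝓛₀u, D_θu)_γ`. [cite: Elgindi2021, §6.2 Definition 6.10, Corollary 6.11 and §6.3 proof of Proposition 6.13 (pp. 17–18 of arXiv:1904.04795)] -/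
theorem localBlockCoercivity_strong {α : ℝ} (hα : 0 ≤ α) (hα1 : α ≤ 1) {u : ℝ → ℝ → ℝ}
    (hu : ContDiff ℝ 3 (uncurry u)) (hs : HasCompactSupport (uncurry u))
    (hsub : tsupport (uncurry u) ⊆ strip) :
    39 / 10 * (∫ p in strip, (Dz u p.1 p.2 * radialWeight p.1) ^ 2 * Real.sin (2 * p.2) ^ (-eta)) +
        4 * 10 ^ 9 * (∫ p in strip, (u p.1 p.2 * radialWeight p.1) ^ 2 * Real.sin (2 * p.2) ^ (-eta)) +
        4 * 10 ^ 16 * (∫ p in strip, (u p.1 p.2 * radialWeight p.1) ^ 2) +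
        10 ^ 20 * (∫ p in strip, (Dθ u p.1 p.2 * radialWeight p.1) ^ 2 * Real.sin (2 * p.2) ^ (-gammaExp α)) ≤
      10 * (∫ p in strip, Dz (opLT0 u) p.1 p.2 * Dz u p.1 p.2 * radialWeight p.1 ^ 2 *
          Real.sin (2 * p.2) ^ (-eta)) +
        10 ^ 10 * (∫ p in strip, opLT0 u p.1 p.2 * u p.1 p.2 * radialWeight p.1 ^ 2 *
          Real.sin (2 * p.2) ^ (-eta)) +
        10 ^ 17 * (∫ p in strip, opLT0 u p.1 p.2 * u p.1 p.2 * radialWeight p.1 ^ 2) +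
        10 ^ 21 * (∫ p in strip, Dθ (opLT0 u) p.1 p.2 * Dθ u p.1 p.2 * radialWeight p.1 ^ 2 *
          Real.sin (2 * p.2) ^ (-gammaExp α)) := by
  have hu2 : ContDiff ℝ 2 (uncurry u) := hu.of_le (by norm_num)
  have hu1 : ContDiff ℝ 1 (uncurry u) := hu.of_le (by norm_num)
  have hd := Dz_opLT0_pairing_ge hα hu hs hsub
  have he := opLT0_pairing_eta_ge hu2 hs hsub
  have h0 := opLT0_pairing_ge hu1 hs hsub
  have ht := Dθ_opLT0_pairing_ge hα hu2 hs hsub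
  have hYw := integral_sq_Dθ_le_weighted hα hu2 hs hsub
  have hAX := integral_sq_le_weighted_eta hu2 hs hsub
  set X : ℝ := ∫ p in strip, (u p.1 p.2 * radialWeight p.1) ^ 2 * Real.sin (2 * p.2) ^ (-eta) with hX
  set Y : ℝ := ∫ p in strip, (Dθ u p.1 p.2 * radialWeight p.1) ^ 2 * Real.sin (2 * p.2) ^ (-gammaExp α) with hY
  set Z : ℝ := ∫ p in strip, (Dz u p.1 p.2 * radialWeight p.1) ^ 2 * Real.sin (2 * p.2) ^ (-eta) with hZ
  set A : ℝ := ∫ p in strip, (u p.1 p.2 * radialWeight p.1) ^ 2 with hA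
  set Yw : ℝ := ∫ p in strip, (Dθ u p.1 p.2 * radialWeight p.1) ^ 2 with hYw'
  have hA0 : 0 ≤ A := integral_nonneg fun p => sq_nonneg _
  have hY0 : 0 ≤ Y := by
    simp only [hY]
    refine setIntegral_nonneg measurableSet_strip fun p hp => ?_
    have hsθ : 0 < Real.sin (2 * p.2) := Real.sin_pos_of_pos_of_lt_pi (by linarith [hp.2.1]) (by linarith [hp.2.2])
    exact mul_nonneg (sq_nonneg _) (Real.rpow_nonneg hsθ.le _)
  have hαY : α * Y ≤ 1 * Y := mul_le_mul_of_nonneg_right hα1 hY0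
  nlinarith [hd, he, h0, ht, hYw, hAX, hαY, hA0, hY0]

end Elgindi


end Literature.Analysis.FluidPDE
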